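import Summits.AtomisticToContinuum.FouriersLaw.Theorems.OddSectorIrreversibilityTapLeakBoundSplitGlue

/-!
# Skeleton line `Sketch` (H1 × C′ split) for crux `TapLeakBound` (P, stmt-AtomisticToContinuum-15159)

(Lead's skeleton, FINAL FORM 2026-08-16T19:40Z. Everything fixed-`N` is LANDED: `stub_correctorSmooth` (p101997,
`Theorems/OddSectorIrreversibilityTapLeakBoundCorrectorSmooth.lean`), `stub_gaussIBP` (p102157, `…GaussIBP.lean`),
`stub_resamplePreserving` (p121225, `…ResamplePreserving.lean`), and `stub_pairingBound` + the resampling calculus +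
the glue `tapLeakBound_of_hermite_of_kickCone : H1 → C′ → TapLeakBound` (p122261, `…SplitGlue.lean`, imported here).
OPEN registered stubs (v5): `stub_hermite` (H1), `stub_kickCone` (C′) — the `N`-uniform children, crux-sized:
PROMOTE to items. Reshape history: v2 orthogonality proved from measure preservation; v3 no sign condition on the
children's constants; v4/v5 the composition goes through the registered, now landed, `stub_pairingBound`.)

Route `OddSectorIrreversibility` (sub-problem `FouriersLaw`), crux P = `TapLeakBound` (rank 4):
for `P = pinnedChain ω₂ lam β γ` (all four `> 0`) and `T > 0` there are `a, C` with `0 < a` such that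
for every `N`, bond `i`, contact `b ∈ {0, N-1}` (`d` = distance of the bond to that contact), the
`C¹ ∩ L²(μ_T)` a.e.-limit `u` of the finite-horizon Kubo correctors and every `0 ≤ s ≤ a·d`:
`|T ∫ ∂_{p_b}u⁺ · ∂_{p_b}(j_i∘Φ_s) dμ_T| ≤ C √((|∫ u J dμ_T| + Z)·Z) · (1 + d - s/a)^{-3/2}`
(`μ_T = e^{-H/T} dq dp` unnormalised, `Z` its mass, `u⁺ = (u + u∘Θ)/2`, `Φ_s` the closed flow = the
zero-friction kernels).

## The line (the route's FORESEEN GLUED SPLIT `P ⇐ H1 + C′`, card `friction-mass-tap-resolvent` side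
of `Cruxes/TapLeakBound/SketchIdeator1.lean`; re-derived by the line lead with the resampling written
on the PRODUCT space, so that no smoothness of the resampling projection `Π_b` is ever needed)

Write `g = j_i ∘ Φ_s`, `𝒩_b f = -T ∂²_{p_b} f + p_b ∂_{p_b} f` (Ornstein–Uhlenbeck tap operator),
`ν = μ_T ⊗ N(0,T)` on `PhaseSpace N × ℝ`, `σ(x, p') = (q, p[b ↦ p'])` (resampling of the contact
momentum). Fixed-`N` Gibbs calculus:

1. `stub_correctorSmooth` — the `C¹` a.e.-limit `u` IS the smooth Kubo corrector: `u ∈ C^∞` and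
   `L_{T,T} u = -J` pointwise (uniqueness of limits + `corrector_smooth`/`corrector_exists` + continuity);
2. `stub_gaussIBP` — one-site Gaussian integration by parts in the limit of the energy cutoffs:
   `T ∫ ∂_b f ∂_b g dμ_T = ∫ (𝒩_b f) g dμ_T` (`f ∈ C²`, `g ∈ C²`, the four factors in `L²(μ_T)`);
3. (proved here from 4) `integral_tapOp_mul_resample_eq_zero` — `∫∫ (𝒩_b f)(x) g(σ(x,p')) dν = 0`
   (transport by `S`, Fubini, and the `p_b`-fibre of `(𝒩_b f) φ_T` is an exact derivative);
4. `stub_resamplePreserving` — the resampling involution `S(x,p') = (σ(x,p'), p_b)` preserves `ν`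
   (hence `g ∘ σ ∈ L²(ν)`, `memLp_resample`, proved here);

and the two `N`-UNIFORM children of the route header (rev 17, "P ⇐ H1 + C′"):

5. `stub_hermite` = H1 `BoundaryHermiteRegularity`: `‖𝒩_b u⁺‖²_{L²(μ_T)} ≤ C_H (|∫ u J dμ_T| + Z)`;
6. `stub_kickCone` = C′ `ResampledKickCone`: `∫∫ (g(σ(x,p')) - g(x))² dN(0,T)(p') dμ_T(x) ≤ C_K Z (1 + d - s/a)^{-3}`
   for `s ≤ a d`.

COMPOSITION (`TapLeakBound_of`, PROVED here): by 1 the hypotheses of P put `u` in `C^∞` with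
`L u = -J`, so `∂_b u⁺ ∈ L²` (tap energy identity, tree) and `g, ∂_b g ∈ L²` (tangent bound, tree);
by 2, `T⟨∂_b u⁺, ∂_b g⟩ = ⟨𝒩_b u⁺, g⟩ = ∫∫ (𝒩_b u⁺)(x) g(x) dν`; by 3 subtract `0 = ∫∫ (𝒩_b u⁺)(x) g(σ(x,p')) dν`;
Cauchy–Schwarz on `L²(ν)` (legitimate by 4) gives `|T⟨∂_b u⁺, ∂_b g⟩| ≤ ‖𝒩_b u⁺‖_{L²(μ_T)} · (∫∫ (g - g∘σ)² dν)^{1/2}`,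
and 5 × 6 close at `C = √(C_H C_K)`, order `3/2 = 3 · ½`.

## Disproof used
`payload.disproof_path` (cdisprove seat folder) is not mounted in this jail and
`Cruxes/TapLeakBound/Disproof.lean` is not yet published (2026-08-16T11:30Z); nothing to honour yet.
The predecessor crux's Negative lane (`ClosedConeSensitivity/Negative/{ZeroFrictionDictionary,
TangentReduction}`) is IMPORTED (dictionary `Φ_s` = Dirac at `detFlow`) and its verdict is respected:
no `L²` norm of the tangent entry `∂_b(j_i∘Φ_s)` is ever taken `N`-uniformly (only at fixed `N`, `s`,
where it is finite, to justify the integration by parts).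
-/

noncomputable section

open MeasureTheory ProbabilityTheory Filter Topology Set Function
open scoped NNReal ENNReal ContDiff

namespace Summit.AtomisticToContinuum.FouriersLaw.Theorems.OddSectorIrreversibility.TapLeak

open Literature.MathematicalPhysics.KineticTheory.HeatConduction
open Summit.AtomisticToContinuum.FouriersLaw.Theses.OddSectorIrreversibility (TapLeakBound)

/-! ### The registered stubs still open (`sorry` lives ONLY here): the two `N`-uniform children of P -/

/-- STUB 5 = H1 `BoundaryHermiteRegularity` (`N`-UNIFORM child of P, route header rev 17; crux-sized).
For `u` exactly as in `TapLeakBound` (the `C¹ ∩ L²(μ_T)` a.e.-limit of the finite-horizon correctors),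
`u⁺ = (u + u∘Θ)/2` and the Ornstein–Uhlenbeck tap operator `𝒩_b = -T∂²_{p_b} + p_b∂_{p_b}` at a
contact `b`: `𝒩_b u⁺ ∈ L²(μ_T)` and `∫ (𝒩_b u⁺)² dμ_T ≤ C (|∫ u J dμ_T| + Z)` with `C = C(ω₂,lam,β,γ,T)`
independent of `N` — the `p_b`-dependence of the even corrector sits on low Hermite modes; harmonic
member `C = 2/γ`. Spelled in the route file's vocabulary (a future item). [conjecture of the route] -/
theorem stub_hermite : ∀ ω₂ lam β γ : ℝ, 0 < ω₂ → 0 < lam → 0 < β → 0 < γ → ∀ T : ℝ, 0 < T →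
    ∃ C : ℝ, ∀ (N : ℕ) (b : Fin N) (u : PhaseSpace N → ℝ), (b.val = 0 ∨ b.val = N - 1) →
      let P := pinnedChain ω₂ lam β γ
      let μT : Measure (PhaseSpace N) :=
        volume.withDensity (fun x : PhaseSpace N => ENNReal.ofReal (Real.exp (-(P.hamiltonian N x) / T)))
      let J : PhaseSpace N → ℝ := fun z => ∑ k : Fin N, P.bondCurrent N k z
      let ue : PhaseSpace N → ℝ := fun x => (u x + u (x.1, -x.2)) / 2
      let Nue : PhaseSpace N → ℝ := fun x => -(T * partialP b (partialP b ue) x) + x.2 b * partialP b ue x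
      ContDiff ℝ 1 u → MemLp u 2 μT →
      (∀ᵐ x ∂μT, Tendsto (fun τ : ℝ => ∫ t in Set.Ioc (0 : ℝ) τ,
          (∫ y, J y ∂(P.transitionKernel N T T t.toNNReal x))) atTop (𝓝 (u x))) →
        MemLp Nue 2 μT ∧
        ∫ x, (Nue x) ^ 2 ∂μT ≤
          C * (|∫ x, u x * J x ∂μT| + ∫ x, Real.exp (-(P.hamiltonian N x) / T) ∂volume) := by
  sorry

/-- STUB 6 = C′ `ResampledKickCone` (`N`-UNIFORM child of P, route header rev 17; crux-sized).
CAPPED resampling differences of the transported current: there are `a > 0`, `C ≥ 0` such that for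
every `N`, bond `i`, contact `b` (distance `d`), `0 ≤ s ≤ a·d`:
`∫ ∫ (j_i(Φ_s(q, p[b ↦ p'])) - j_i(Φ_s(q,p)))² dN(0,T)(p') dμ_T(q,p) ≤ C · Z · (1 + d - s/a)^{-3}`
(`Φ_s` written as the zero-friction kernels, as in P; immune to the tangent amplifiers that kill the
held E3; linear window, polynomial tail of the order 3 that P's 3/2 needs). Spelled in the route
file's vocabulary (a future item). [conjecture of the route] -/
theorem stub_kickCone : ∀ ω₂ lam β γ : ℝ, 0 < ω₂ → 0 < lam → 0 < β → 0 < γ → ∀ T : ℝ, 0 < T →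
    ∃ a C : ℝ, 0 < a ∧ ∀ (N : ℕ) (i b : Fin N) (s : ℝ), (b.val = 0 ∨ b.val = N - 1) → 0 ≤ s →
      let P := pinnedChain ω₂ lam β γ
      let P₀ := pinnedChain ω₂ lam β 0
      let μT : Measure (PhaseSpace N) :=
        volume.withDensity (fun x : PhaseSpace N => ENNReal.ofReal (Real.exp (-(P.hamiltonian N x) / T)))
      let js : PhaseSpace N → ℝ := fun x => ∫ y, P.bondCurrent N i y ∂(P₀.transitionKernel N T T s.toNNReal x)
      let d : ℕ := if b.val = 0 then i.val else N - 2 - i.val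
      s ≤ a * (d : ℝ) →
        ∫ x, (∫ p', (js (x.1, Function.update x.2 b p') - js x) ^ 2 ∂(gaussianReal 0 (Real.toNNReal T))) ∂μT
          ≤ C * (∫ x, Real.exp (-(P.hamiltonian N x) / T) ∂volume) / (1 + ((d : ℝ) - s / a)) ^ 3 := by
  sorry

/-! ### The composition (PROVED and LANDED as `tapLeakBound_of_hermite_of_kickCone`, p122261) -/

/-- **COMPOSITION.** The two remaining stubs imply the crux `TapLeakBound`, by name, through the landed glue
theorem (identification of the corrector, Gaussian integration by parts, resampling orthogonality, Cauchy–Schwarz on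
`L²(μ_T ⊗ N(0,T))`, `max C 0` arithmetic — all in the tree). [folklore] -/
theorem TapLeakBound_of : TapLeakBound :=
  tapLeakBound_of_hermite_of_kickCone stub_hermite stub_kickCone

end Summit.AtomisticToContinuum.FouriersLaw.Theorems.OddSectorIrreversibility.TapLeak

end
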